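import Summits.ValiantsHypothesis.ValiantsHypothesis.Theorems.KPlusLogSqLawRealStaticNormalForm
import Summits.ValiantsHypothesis.ValiantsHypothesis.Theorems.LacunarySymmetroidMatrixDescartesChainSectorCore

/-!
# Route «KPlusLogSqLaw» — THE SIGNED VERTEX-GAUGE NORMAL FORM: Conjecture B ⟺ the vertex-gauge inertia law WITH SIGNS

HONEST FRAMING.  Helper bookkeeping for the OPEN crux `WeakLifting` (stmt-ValiantsHypothesis-19561, route `KPlusLogSqLaw`, cell `pub-symmetroid`;
seat val-sym-lift-p4 g25, 2026-08-29), the endpoint of the seat's real-side normal forms (`…RealStaticNormalForm`, `…RealDiagonalLetterOne`,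
`…RealSymmRowMonomialLetters`).  Nothing here asserts `WeakLifting`, `TropicalB`, Conjecture B (`KPlusLogSqLaw`), `MatrixDescartes`
(stmt-ValiantsHypothesis-18050) or anything about VP ≠ VNP.

THE POINT.  The «vertex gauge» of the cell (`KPlusLogSqLaw.MonotoneInertia.card_posRoots_vertexGauge_le`, lift-p2 g10: for `C'` symmetric,
`aᵢ > 0`, `eᵢ ≥ 1`, `det (diagonal (aᵢ X^{eᵢ}) + C')` has at most `ν₋(C')` positive zeros — a CONSTANT symmetric letter plus POSITIVE diagonal
monomials) is the UNIVERSAL shape of Conjecture B once the rates `aᵢ` may have BOTH SIGNS.  Construction (`exists_signedVertexGauge`): by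
POLARISATION (`polarization_apply`) every symmetric letter is `S = ∑_{i,j} (S i j/4)·((eᵢ+eⱼ)(eᵢ+eⱼ)ᵀ − (eᵢ−eⱼ)(eᵢ−eⱼ)ᵀ)`, an explicit signed
rank-one decomposition; put the signed rates on the DIAGONAL: `G(X) = [[diagonal (j_r X^{2 d_{l(r)}}), Q], [Qᵀ, 0]]` with CONSTANT `Q` (rows
`eᵢ ± eⱼ`) and constant signed `j_r = −1/c_r`; for real `x ≠ 0` the Schur complement of the (invertible, diagonal) top-left block is
`∑_l x^{−2 d_l} S_l` (`det_fromBlocks_diagonal`, `eval_det_pencil`), so `det G(x) = (∏_r j_r x^{2d}) · det F(x⁻²)` and `t ↦ (√t)⁻¹` injects the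
positive zeros of `det F` into those of `det G`.  Hence:
* `posRootLawAt_of_signedVertexGauge` — SYMMETRIC pencils of format `(K·(m·(m·2)) + m, K + 1)` with ONE arbitrary symmetric letter (index 0)
  and DIAGONAL letters otherwise bound the census row `PosRootLawAt m K` (ζ-currency, same budget);
* ★ `kPlusLogSqLaw_iff_signedVertexGauge` — **Conjecture B ⟺ `∃ C`, every real symmetric pencil `C'·X^{d₀} + ∑_{l ≥ 1} X^{d_l} D_l` with
  `C'` symmetric and `D_l` DIAGONAL (signed) has at most `2^(C (K + ⌊log₂ n⌋²))` distinct POSITIVE zeros of its determinant**.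
  With all diagonal rates of one sign this is the kernel inertia law above (bound `ν₋(C') ≤ n`, for EVERY `K`); so the entire content of
  Conjecture B is the MIXED-SIGN vertex gauge: one constant symmetric letter against two Loewner-monotone diagonal monomial families of
  opposite sign.  An EQUIVALENCE between OPEN statements; neither side is asserted.
[folklore] polarisation; Schur complement; the cell's vertex gauge (lift-p1 g10 / lift-p3 g9 / lift-p2 g10).
-/

set_option linter.dupNamespace false
set_option autoImplicit false

namespace Summit.ValiantsHypothesis.ValiantsHypothesis.Theorems.KPlusLogSqLaw.RealStatic

open Summit.ValiantsHypothesis.ValiantsHypothesis.Theorems.LacunarySymmetroidMatrixDescartes (RealRootLawAt KPlusLogSqLaw)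
open Summit.ValiantsHypothesis.ValiantsHypothesis.Theorems.MatrixDescartes.Negative (PosRootLawAt)
open Summit.ValiantsHypothesis.ValiantsHypothesis.Theorems.LacunarySymmetroidMatrixDescartes.ChainSector (eval_det_pencil)
open scoped BigOperators Matrix
open Polynomial

section Polarization

variable {m : ℕ}

/-- **polarisation**: for a symmetric real matrix,
`∑_{i,j} (S i j / 4)·((δₐᵢ+δₐⱼ)(δ_bᵢ+δ_bⱼ) − (δₐᵢ−δₐⱼ)(δ_bᵢ−δ_bⱼ)) = S a b` — an explicit signed rank-one decomposition by the vectors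
`eᵢ ± eⱼ` with no case distinction. [folklore] -/
theorem polarization_apply (S : Matrix (Fin m) (Fin m) ℝ) (hS : S.IsSymm) (a b : Fin m) :
    (∑ i : Fin m, ∑ j : Fin m, S i j / 4 *
      ((((if a = i then (1:ℝ) else 0) + (if a = j then 1 else 0)) * ((if b = i then (1:ℝ) else 0) + (if b = j then 1 else 0))) -
        (((if a = i then (1:ℝ) else 0) - (if a = j then 1 else 0)) * ((if b = i then (1:ℝ) else 0) - (if b = j then 1 else 0)))))
      = S a b := by
  have key : ∀ i j : Fin m,
      S i j / 4 * ((((if a = i then (1:ℝ) else 0) + (if a = j then 1 else 0)) * ((if b = i then (1:ℝ) else 0) + (if b = j then 1 else 0))) -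
        (((if a = i then (1:ℝ) else 0) - (if a = j then 1 else 0)) * ((if b = i then (1:ℝ) else 0) - (if b = j then 1 else 0))))
        = S i j / 2 * ((if a = i then (1:ℝ) else 0) * (if b = j then (1:ℝ) else 0)) +
          S i j / 2 * ((if a = j then (1:ℝ) else 0) * (if b = i then (1:ℝ) else 0)) := by
    intro i j; ring
  rw [Finset.sum_congr rfl fun i _ => Finset.sum_congr rfl fun j _ => key i j]
  simp_rw [Finset.sum_add_distrib]
  have hA : (∑ i : Fin m, ∑ j : Fin m, S i j / 2 * ((if a = i then (1:ℝ) else 0) * (if b = j then (1:ℝ) else 0))) = S a b / 2 := by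
    rw [Finset.sum_eq_single a (fun i _ hi => by simp [Ne.symm hi]) (fun h => absurd (Finset.mem_univ a) h)]
    rw [Finset.sum_eq_single b (fun j _ hj => by simp [Ne.symm hj]) (fun h => absurd (Finset.mem_univ b) h)]
    simp
  have hB : (∑ i : Fin m, ∑ j : Fin m, S i j / 2 * ((if a = j then (1:ℝ) else 0) * (if b = i then (1:ℝ) else 0))) = S b a / 2 := by
    rw [Finset.sum_eq_single b (fun i _ hi => by simp [Ne.symm hi]) (fun h => absurd (Finset.mem_univ b) h)]
    rw [Finset.sum_eq_single a (fun j _ hj => by simp [Ne.symm hj]) (fun h => absurd (Finset.mem_univ a) h)]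
    simp
  rw [hA, hB, hS.apply b a]
  ring

end Polarization

section Generic

/-- real Schur complement with an invertible DIAGONAL top-left block: `det [[diag w, B],[Bᵀ, 0]] = (∏ w) · det(−Bᵀ·diag(w⁻¹)·B)`.
[folklore] -/
theorem det_fromBlocks_diagonal {ρ ι : Type*} [Fintype ρ] [DecidableEq ρ] [Fintype ι] [DecidableEq ι]
    (w : ρ → ℝ) (hw : ∀ r, w r ≠ 0) (B : Matrix ρ ι ℝ) :
    (Matrix.fromBlocks (Matrix.diagonal w) B Bᵀ (0 : Matrix ι ι ℝ)).det
      = (∏ r, w r) * (-(Bᵀ * Matrix.diagonal (fun r => (w r)⁻¹) * B)).det := by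
  have hunit : IsUnit (Matrix.diagonal w).det := by
    rw [Matrix.det_diagonal]
    exact isUnit_iff_ne_zero.mpr (Finset.prod_ne_zero_iff.mpr fun r _ => hw r)
  letI : Invertible (Matrix.diagonal w) := Matrix.invertibleOfIsUnitDet _ hunit
  have hright : Matrix.diagonal w * Matrix.diagonal (fun r => (w r)⁻¹) = 1 := by
    rw [Matrix.diagonal_mul_diagonal, ← Matrix.diagonal_one]
    congr 1
    funext r
    exact mul_inv_cancel₀ (hw r)
  rw [Matrix.det_fromBlocks₁₁, Matrix.det_diagonal, Matrix.invOf_eq_nonsing_inv, Matrix.inv_eq_right_inv hright, zero_sub]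

end Generic

section Construction

variable {m K : ℕ}

/-- the per-term identity behind the Schur complement of the signed vertex gauge: with `c = coef`, `j = if c = 0 then 1 else −c⁻¹`,
`Q = if c = 0 then 0 else v`, one has `Q_a · (j·y)⁻¹ · Q_b = −(c · y⁻¹ · v_a v_b)`. [folklore] -/
theorem gauge_term (c va vb y : ℝ) :
    (if c = 0 then 0 else va) * ((if c = 0 then (1:ℝ) else -c⁻¹) * y)⁻¹ * (if c = 0 then 0 else vb)
      = -(c * y⁻¹ * (va * vb)) := by
  by_cases hc : c = 0
  · simp [hc]
  · rw [if_neg hc, if_neg hc, if_neg hc, mul_inv, inv_neg, inv_inv]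
    ring

/-- the `σ`-sum of the signed rank-one terms of one entry pair is the polarisation summand. [folklore] -/
theorem gauge_pair_sum (s δai δaj δbi δbj : ℝ) :
    (∑ σ : Fin 2, ((if σ = 0 then (1:ℝ) else -1) * s / 4) *
        (((δai + (if σ = 0 then (1:ℝ) else -1) * δaj)) * (δbi + (if σ = 0 then (1:ℝ) else -1) * δbj)))
      = s / 4 * (((δai + δaj) * (δbi + δbj)) - ((δai - δaj) * (δbi - δbj))) := by
  rw [Fin.sum_univ_two]
  simp only [if_true, show (1 : Fin 2) ≠ 0 from by decide, if_false]
  ring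

/-- **SIGNED VERTEX GAUGE, existence form.**  For every symmetric `K`-term `m × m` pencil there is a SYMMETRIC `(K+1)`-term pencil of size
`K·(m·(m·2)) + m` with ONE arbitrary symmetric letter (index `0`) and DIAGONAL letters otherwise, with at least as many distinct POSITIVE
zeros of its determinant (in fact the same number: `x ↦ x⁻²` is a bijection of positive zero sets). [folklore] -/
theorem exists_signedVertexGauge (d : Fin K → ℕ) (S : Fin K → Matrix (Fin m) (Fin m) ℝ) (hS : ∀ l, (S l).IsSymm) :
    ∃ (d' : Fin (K + 1) → ℕ) (E : Fin (K + 1) → Matrix (Fin (K * (m * (m * 2)) + m)) (Fin (K * (m * (m * 2)) + m)) ℝ),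
      (∀ l, (E l).IsSymm) ∧ (∀ l : Fin (K + 1), 1 ≤ (l : ℕ) → ∀ x y, x ≠ y → E l x y = 0) ∧
      ((Matrix.det (∑ l, ((Polynomial.X : Polynomial ℝ) ^ d l) • (S l).map Polynomial.C)).roots.toFinset.filter
          (fun t => 0 < t)).card ≤
        ((Matrix.det (∑ l, ((Polynomial.X : Polynomial ℝ) ^ d' l) • (E l).map Polynomial.C)).roots.toFinset.filter
          (fun t => 0 < t)).card := by
  classical
  -- index set of the signed rank-one terms: class, row, column, sign
  let ρ := Fin K × (Fin m × (Fin m × Fin 2))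
  let sg : Fin 2 → ℝ := fun σ => if σ = 0 then 1 else -1
  let coef : ρ → ℝ := fun r => sg r.2.2.2 * S r.1 r.2.1 r.2.2.1 / 4
  let vec : ρ → Fin m → ℝ := fun r k => (if k = r.2.1 then (1:ℝ) else 0) + sg r.2.2.2 * (if k = r.2.2.1 then 1 else 0)
  let Q : Matrix ρ (Fin m) ℝ := Matrix.of fun r k => if coef r = 0 then 0 else vec r k
  let jr : ρ → ℝ := fun r => if coef r = 0 then 1 else -(coef r)⁻¹
  have hjr : ∀ r, jr r ≠ 0 := by
    intro r; simp only [jr]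
    split_ifs with h
    · exact one_ne_zero
    · exact neg_ne_zero.mpr (inv_ne_zero h)
  -- the block pencil on `ρ ⊕ Fin m`
  let T : Fin (K + 1) → Matrix (ρ ⊕ Fin m) (ρ ⊕ Fin m) ℝ :=
    Fin.cons (Matrix.fromBlocks 0 Q Qᵀ 0)
      (fun l => Matrix.fromBlocks (Matrix.diagonal fun r : ρ => if r.1 = l then jr r else 0) 0 0 0)
  let d' : Fin (K + 1) → ℕ := Fin.cons 0 (fun l => 2 * d l)
  let eρ : ρ ≃ Fin (K * (m * (m * 2))) :=
    (Equiv.prodCongr (Equiv.refl (Fin K))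
      ((Equiv.prodCongr (Equiv.refl (Fin m)) finProdFinEquiv).trans finProdFinEquiv)).trans finProdFinEquiv
  let e : ρ ⊕ Fin m ≃ Fin (K * (m * (m * 2)) + m) := (Equiv.sumCongr eρ (Equiv.refl (Fin m))).trans finSumFinEquiv
  -- the two determinants
  set p : Polynomial ℝ := Matrix.det (∑ l, ((Polynomial.X : Polynomial ℝ) ^ d l) • (S l).map Polynomial.C) with hp
  set q : Polynomial ℝ := Matrix.det (∑ l, ((Polynomial.X : Polynomial ℝ) ^ d' l) • (T l).map Polynomial.C) with hq
  -- (1) the block pencil evaluated at a real point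
  have hevalT : ∀ x : ℝ, (∑ l, (x ^ d' l) • T l)
      = Matrix.fromBlocks (Matrix.diagonal fun r : ρ => jr r * x ^ (2 * d r.1)) Q Qᵀ 0 := by
    intro x
    refine Matrix.ext fun u v => ?_
    rw [Matrix.sum_apply, Fin.sum_univ_succ]
    simp only [d', T, Fin.cons_zero, Fin.cons_succ, pow_zero, Matrix.smul_apply, smul_eq_mul, one_mul]
    rcases u with r | a <;> rcases v with r' | b
    · simp only [Matrix.fromBlocks_apply₁₁, Matrix.zero_apply, zero_add, Matrix.diagonal_apply]
      by_cases h : r = r'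
      · subst h
        simp only [if_true]
        rw [Finset.sum_eq_single r.1 (fun l _ hl => by rw [if_neg (Ne.symm hl), mul_zero])
          (fun h => absurd (Finset.mem_univ _) h)]
        rw [if_pos rfl, mul_comm]
      · simp [h]
    · simp
    · simp
    · simp
  -- (2) the Schur complement of the evaluated block pencil is the original pencil at `x⁻²`
  have hpair : ∀ (l : Fin K) (i j : Fin m) (a b : Fin m) (c : ℝ),
      (∑ σ : Fin 2, coef (l, (i, (j, σ))) * c * (vec (l, (i, (j, σ))) a * vec (l, (i, (j, σ))) b))
        = c * (S l i j / 4 * ((((if a = i then (1:ℝ) else 0) + (if a = j then 1 else 0)) *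
            ((if b = i then (1:ℝ) else 0) + (if b = j then 1 else 0))) -
          (((if a = i then (1:ℝ) else 0) - (if a = j then 1 else 0)) *
            ((if b = i then (1:ℝ) else 0) - (if b = j then 1 else 0))))) := by
    intro l i j a b c
    rw [Fin.sum_univ_two]
    simp only [coef, vec, sg, if_true, show (1 : Fin 2) ≠ 0 from by decide, if_false]
    ring
  have hschur : ∀ x : ℝ, x ≠ 0 →
      -(Qᵀ * Matrix.diagonal (fun r : ρ => (jr r * x ^ (2 * d r.1))⁻¹) * Q) = ∑ l, ((x ^ 2)⁻¹) ^ d l • S l := by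
    intro x hx
    refine Matrix.ext fun a b => ?_
    rw [Matrix.neg_apply, Matrix.mul_apply]
    simp only [Matrix.mul_diagonal, Matrix.transpose_apply]
    have hterm : ∀ r : ρ, Q r a * (jr r * x ^ (2 * d r.1))⁻¹ * Q r b
        = -(coef r * ((x ^ 2)⁻¹) ^ d r.1 * (vec r a * vec r b)) := by
      intro r
      simp only [Q, jr, Matrix.of_apply]
      rw [show ((x ^ 2)⁻¹) ^ (d r.1) = (x ^ (2 * d r.1))⁻¹ by rw [pow_mul, inv_pow]]
      exact gauge_term (coef r) (vec r a) (vec r b) (x ^ (2 * d r.1))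
    rw [Finset.sum_congr rfl fun r _ => hterm r, Finset.sum_neg_distrib, neg_neg, Matrix.sum_apply]
    simp only [Matrix.smul_apply, smul_eq_mul]
    rw [Fintype.sum_prod_type]
    refine Finset.sum_congr rfl fun l _ => ?_
    rw [← polarization_apply (S l) (hS l) a b, Finset.mul_sum, Fintype.sum_prod_type]
    refine Finset.sum_congr rfl fun i _ => ?_
    rw [Finset.mul_sum, Fintype.sum_prod_type]
    refine Finset.sum_congr rfl fun j _ => ?_
    exact hpair l i j a b _
  -- (3) evaluation identity: q(x) = (∏ w) · p(x⁻²) for x ≠ 0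
  have heval : ∀ x : ℝ, x ≠ 0 →
      q.eval x = (∏ r : ρ, jr r * x ^ (2 * d r.1)) * p.eval ((x ^ 2)⁻¹) := by
    intro x hx
    have hw : ∀ r : ρ, jr r * x ^ (2 * d r.1) ≠ 0 := fun r => mul_ne_zero (hjr r) (pow_ne_zero _ hx)
    rw [hq, eval_det_pencil, hevalT x, det_fromBlocks_diagonal _ hw, hschur x hx, hp, eval_det_pencil]
  -- (4) the letters: symmetric, and diagonal beyond index 0
  have hT : ∀ l, (T l).IsSymm := by
    intro l
    induction l using Fin.cases with
    | zero =>
      simp only [T, Fin.cons_zero]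
      exact Matrix.IsSymm.fromBlocks (A := (0 : Matrix ρ ρ ℝ)) (D := (0 : Matrix (Fin m) (Fin m) ℝ))
        Matrix.isSymm_zero rfl Matrix.isSymm_zero
    | succ l₀ =>
      simp only [T, Fin.cons_succ]
      exact Matrix.IsSymm.fromBlocks (B := (0 : Matrix ρ (Fin m) ℝ)) (C := (0 : Matrix (Fin m) ρ ℝ))
        (D := (0 : Matrix (Fin m) (Fin m) ℝ)) (Matrix.isSymm_diagonal _) Matrix.transpose_zero Matrix.isSymm_zero
  have hsymm : ∀ l, (Matrix.reindex e e (T l)).IsSymm := fun l => (hT l).submatrix _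
  have hdiag : ∀ l : Fin (K + 1), 1 ≤ (l : ℕ) → ∀ x y, x ≠ y → Matrix.reindex e e (T l) x y = 0 := by
    intro l hl x y hxy
    obtain ⟨l₀, rfl⟩ : ∃ l₀ : Fin K, l = l₀.succ := ⟨l.pred (by intro h; simp [h] at hl), by simp⟩
    simp only [Matrix.reindex_apply, Matrix.submatrix_apply, T, Fin.cons_succ]
    have hne : e.symm x ≠ e.symm y := fun h => hxy (e.symm.injective h)
    rcases hu : e.symm x with r | a <;> rcases hv : e.symm y with r' | b <;> rw [hu, hv] at hne
    · exact (Matrix.fromBlocks_apply₁₁ _ _ _ _ r r').trans (Matrix.diagonal_apply_ne _ fun h => hne (by rw [h]))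
    · simp
    · simp
    · simp
  -- (5) reindexing does not change the determinant
  have hre : (∑ l, ((Polynomial.X : Polynomial ℝ) ^ d' l) • (Matrix.reindex e e (T l)).map Polynomial.C)
      = Matrix.reindex e e (∑ l, ((Polynomial.X : Polynomial ℝ) ^ d' l) • (T l).map Polynomial.C) := by
    refine Matrix.ext fun x y => ?_
    simp [Matrix.sum_apply]
  refine ⟨d', fun l => Matrix.reindex e e (T l), hsymm, hdiag, ?_⟩
  rw [hre, Matrix.det_reindex_self, ← hq]
  -- (6) positive zeros of `p` inject into positive zeros of `q` by `t ↦ (√t)⁻¹`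
  by_cases hp0 : p = 0
  · simp [hp0]
  have hq0 : q ≠ 0 := by
    obtain ⟨t₀, ht₀pos, ht₀⟩ : ∃ t₀ : ℝ, 0 < t₀ ∧ p.eval t₀ ≠ 0 := by
      obtain ⟨t₀, ht₀mem, ht₀not⟩ := (Set.Ioi_infinite (0:ℝ)).exists_notMem_finset p.roots.toFinset
      refine ⟨t₀, ht₀mem, fun h0 => ht₀not ?_⟩
      rw [Multiset.mem_toFinset, Polynomial.mem_roots hp0]
      exact h0
    have hx₀ : (Real.sqrt t₀)⁻¹ ≠ 0 := inv_ne_zero (Real.sqrt_ne_zero'.mpr ht₀pos)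
    intro hq0'
    have h1 := heval _ hx₀
    rw [hq0', Polynomial.eval_zero, inv_pow, inv_inv, Real.sq_sqrt ht₀pos.le] at h1
    exact (mul_ne_zero (Finset.prod_ne_zero_iff.mpr fun r _ => mul_ne_zero (hjr r) (pow_ne_zero _ hx₀)) ht₀) h1.symm
  refine Finset.card_le_card_of_injOn (fun t => (Real.sqrt t)⁻¹) ?_ ?_
  · intro t ht
    rw [Finset.mem_coe, Finset.mem_filter, Multiset.mem_toFinset, Polynomial.mem_roots hp0] at ht
    obtain ⟨hroot, htpos⟩ := ht
    rw [Finset.mem_coe, Finset.mem_filter, Multiset.mem_toFinset, Polynomial.mem_roots hq0]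
    refine ⟨?_, inv_pos.mpr (Real.sqrt_pos.mpr htpos)⟩
    have hx : (Real.sqrt t)⁻¹ ≠ 0 := inv_ne_zero (Real.sqrt_ne_zero'.mpr htpos)
    rw [Polynomial.IsRoot.def, heval _ hx, inv_pow, inv_inv, Real.sq_sqrt htpos.le]
    rw [Polynomial.IsRoot.def] at hroot
    rw [hroot, mul_zero]
  · intro t ht t' ht' h
    rw [Finset.coe_filter] at ht ht'
    have h2 : Real.sqrt t = Real.sqrt t' := inv_injective h
    exact (Real.sqrt_inj ht.2.le ht'.2.le).mp h2

end Construction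

/-! ## Row transfer and the equivalence with Conjecture B -/

section Rows

open Summit.ValiantsHypothesis.ValiantsHypothesis.Theorems.LacunarySymmetroidMatrixDescartes.Census
  (realRootLawAt_mono posRootLawAt_of_realRootLawAt realRootLawAt_of_posRootLawAt)
open Summit.ValiantsHypothesis.ValiantsHypothesis.Theorems.LacunarySymmetroidMatrixDescartes.TropicalCensus (realRootLawAt_zero)

variable {m K : ℕ}

/-- **Signed vertex-gauge rows bound the census ζ-row**: if every SYMMETRIC real pencil of format `(K·(m·(m·2)) + m, K + 1)` with one arbitrary
symmetric letter (index `0`) and DIAGONAL letters otherwise has at most `B` distinct positive zeros of its determinant, then `PosRootLawAt m K B`.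
[folklore] -/
theorem posRootLawAt_of_signedVertexGauge {B : ℕ}
    (h : ∀ (d' : Fin (K + 1) → ℕ) (E : Fin (K + 1) → Matrix (Fin (K * (m * (m * 2)) + m)) (Fin (K * (m * (m * 2)) + m)) ℝ),
      (∀ l, (E l).IsSymm) → (∀ l : Fin (K + 1), 1 ≤ (l : ℕ) → ∀ x y, x ≠ y → E l x y = 0) →
      ((Matrix.det (∑ l, ((Polynomial.X : Polynomial ℝ) ^ d' l) • (E l).map Polynomial.C)).roots.toFinset.filter
          (fun t => 0 < t)).card ≤ B) :
    PosRootLawAt m K B := by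
  intro d S hS
  obtain ⟨d', E, hsy, hdg, hle⟩ := exists_signedVertexGauge d S hS
  exact hle.trans (h d' E hsy hdg)

/-- size arithmetic: `1 ≤ K`, `K + 1 ≤ m ⇒ C((K+1) + ⌊log₂ (K·(m·(m·2)) + m)⌋²) ≤ 36·C·(K + ⌊log₂ m⌋²)`. [folklore] -/
theorem gauge_size_exponent_le (C m K : ℕ) (hK : 1 ≤ K) (hKm : K + 1 ≤ m) :
    C * ((K + 1) + Nat.log 2 (K * (m * (m * 2)) + m) ^ 2) ≤ 36 * C * (K + Nat.log 2 m ^ 2) := by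
  set L := Nat.log 2 m with hL
  have hm2 : 2 ≤ m := by omega
  have hL1 : 1 ≤ L := by
    rw [hL]; exact Nat.le_log_of_pow_le (by norm_num) (by simpa using hm2)
  have hm : m < 2 ^ (L + 1) := Nat.lt_pow_succ_log_self one_lt_two m
  have hN1 : K * (m * (m * 2)) + m ≤ m * (m * (m * 2)) := by
    have hX : m ≤ m * (m * 2) := by nlinarith
    calc K * (m * (m * 2)) + m ≤ K * (m * (m * 2)) + m * (m * 2) := Nat.add_le_add_left hX _
      _ = (K + 1) * (m * (m * 2)) := by ring
      _ ≤ m * (m * (m * 2)) := Nat.mul_le_mul_right _ hKm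
  have hN2 : m * (m * (m * 2)) < 2 ^ (3 * L + 4) := by
    have hm3 : m ^ 3 < (2 ^ (L + 1)) ^ 3 := Nat.pow_lt_pow_left hm (by norm_num)
    have e : 2 ^ (3 * L + 4) = 2 * (2 ^ (L + 1)) ^ 3 := by
      rw [← pow_mul, ← pow_succ']; congr 1; ring
    rw [e, show m * (m * (m * 2)) = 2 * m ^ 3 by ring]
    omega
  have hlogN : Nat.log 2 (K * (m * (m * 2)) + m) ≤ 3 * L + 3 := by
    have hne : K * (m * (m * 2)) + m ≠ 0 := by positivity
    have := Nat.log_lt_of_lt_pow hne (lt_of_le_of_lt hN1 hN2)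
    omega
  have hsq : Nat.log 2 (K * (m * (m * 2)) + m) ^ 2 ≤ 36 * L ^ 2 := by
    calc Nat.log 2 (K * (m * (m * 2)) + m) ^ 2 ≤ (3 * L + 3) ^ 2 := Nat.pow_le_pow_left hlogN 2
      _ ≤ 36 * L ^ 2 := by nlinarith
  have h3 : (K + 1) + Nat.log 2 (K * (m * (m * 2)) + m) ^ 2 ≤ 36 * (K + L ^ 2) := by nlinarith
  calc C * ((K + 1) + Nat.log 2 (K * (m * (m * 2)) + m) ^ 2) ≤ C * (36 * (K + L ^ 2)) := Nat.mul_le_mul_left _ h3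
    _ = 36 * C * (K + L ^ 2) := by ring

/-- **Conjecture B ⟺ THE SIGNED VERTEX-GAUGE LAW**: `KPlusLogSqLaw ↔ ∃ C`, every SYMMETRIC real lacunary pencil with ONE arbitrary symmetric
letter (index `0`) and DIAGONAL letters otherwise has at most `2^(C (K + ⌊log₂ n⌋²))` distinct POSITIVE zeros of its determinant.  With one-signed
diagonal rates the right-hand side is the tree's inertia law `MonotoneInertia.card_posRoots_vertexGauge_le`; the open content is the signs.
An EQUIVALENCE between OPEN statements; neither side is asserted. [folklore] -/
theorem kPlusLogSqLaw_iff_signedVertexGauge :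
    KPlusLogSqLaw ↔ ∃ C : ℕ, ∀ (n K' : ℕ) (d : Fin K' → ℕ) (E : Fin K' → Matrix (Fin n) (Fin n) ℝ),
      (∀ l, (E l).IsSymm) → (∀ l : Fin K', 1 ≤ (l : ℕ) → ∀ x y, x ≠ y → E l x y = 0) →
      ((Matrix.det (∑ l, ((Polynomial.X : Polynomial ℝ) ^ d l) • (E l).map Polynomial.C)).roots.toFinset.filter
          (fun t => 0 < t)).card ≤ 2 ^ (C * (K' + Nat.log 2 n ^ 2)) := by
  constructor
  · rintro ⟨C, hC⟩
    exact ⟨C, fun n K' d E hsy _ => posRootLawAt_of_realRootLawAt (hC n K') d E hsy⟩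
  · rintro ⟨C, hC⟩
    refine ⟨36 * C + 2, fun m K => ?_⟩
    rcases Nat.eq_zero_or_pos K with rfl | hK
    · exact realRootLawAt_zero m _
    by_cases hmK : m ≤ K
    · refine realRootLawAt_mono ?_ (realRootLawAt_fatCone_zero m K hmK)
      exact Nat.pow_le_pow_right two_pos (Nat.mul_le_mul_right _ (by omega))
    · have hKm : K + 1 ≤ m := by omega
      have hpos : PosRootLawAt m K (2 ^ (C * ((K + 1) + Nat.log 2 (K * (m * (m * 2)) + m) ^ 2))) :=
        posRootLawAt_of_signedVertexGauge fun d' E hsy hdg => hC _ _ d' E hsy hdg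
      refine realRootLawAt_mono ?_ (realRootLawAt_of_posRootLawAt hpos)
      have h1 := gauge_size_exponent_le C m K hK hKm
      have h2 : 2 ^ (C * ((K + 1) + Nat.log 2 (K * (m * (m * 2)) + m) ^ 2)) ≤ 2 ^ (36 * C * (K + Nat.log 2 m ^ 2)) :=
        Nat.pow_le_pow_right two_pos h1
      have h3 : 2 * 2 ^ (36 * C * (K + Nat.log 2 m ^ 2)) + 1 ≤ 2 ^ (36 * C * (K + Nat.log 2 m ^ 2) + 2) := by
        rw [pow_add]; have := Nat.one_le_two_pow (n := 36 * C * (K + Nat.log 2 m ^ 2)); omega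
      have h4 : 36 * C * (K + Nat.log 2 m ^ 2) + 2 ≤ (36 * C + 2) * (K + Nat.log 2 m ^ 2) := by nlinarith
      calc 2 * 2 ^ (C * ((K + 1) + Nat.log 2 (K * (m * (m * 2)) + m) ^ 2)) + 1
          ≤ 2 * 2 ^ (36 * C * (K + Nat.log 2 m ^ 2)) + 1 := by omega
        _ ≤ 2 ^ (36 * C * (K + Nat.log 2 m ^ 2) + 2) := h3
        _ ≤ 2 ^ ((36 * C + 2) * (K + Nat.log 2 m ^ 2)) := Nat.pow_le_pow_right two_pos h4

end Rows


end Summit.ValiantsHypothesis.ValiantsHypothesis.Theorems.KPlusLogSqLaw.RealStatic
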